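import Summits.QuantumAdvantage.QuantumAdvantage.Theorems.CubicForrelationNearExactIsExactTenBalancedA
import Summits.QuantumAdvantage.QuantumAdvantage.Theorems.CubicForrelationNearExactIsExactTypeE8
import Summits.QuantumAdvantage.QuantumAdvantage.Theorems.CubicForrelationNearExactIsExactQuadBalancedStructure
import Summits.QuantumAdvantage.QuantumAdvantage.Theorems.CubicForrelationNearExactIsExactLevelOnHyperplane
import Summits.QuantumAdvantage.QuantumAdvantage.Theorems.CubicForrelationNearExactIsExactLinearTransport
import Summits.QuantumAdvantage.QuantumAdvantage.Theorems.CubicForrelationNearExactIsExactTenPeel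
import Summits.QuantumAdvantage.QuantumAdvantage.Theorems.CubicForrelationNearExactIsExactBasisWithTwo
import Summits.QuantumAdvantage.QuantumAdvantage.Theorems.CubicForrelationNearExactIsExactEightBitEndgame
import Summits.QuantumAdvantage.QuantumAdvantage.Theorems.CubicForrelationNearExactIsExactAffineForm
import Summits.QuantumAdvantage.QuantumAdvantage.Theorems.CubicForrelationNearExactIsExactDerivDegree
import Summits.QuantumAdvantage.QuantumAdvantage.Theorems.CubicForrelationNearExactIsExactRothausB
import Summits.QuantumAdvantage.QuantumAdvantage.Theorems.CubicForrelationNearExactIsExactIsolationSmallN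

/-!
# Crux `CubicForrelation.NearExactIsExact` (stmt-QuantumAdvantage-14043), line `direct-sum-amplification`, lead c6 cycle 2:
  the BALANCED split at `n = 10`, `θ = 7/8` is empty

By the tower (`split_ten_both`, landed) a cubic pair on 10 bits with `7/8 < Φ(f,g) < 1` is SPLIT: `W_g ≡ 16 (mod 32)` exactly
on an affine hyperplane `{c·x = b₀}`.  This file proves that the quadratic `δ := D_c g` is UNBALANCED
(`ten_splitDerivative_unbalanced`; the window corollary is in `…TenWindow.lean`).  Balanced `δ` has a complementing structure
`e` (`stub_quadBalancedStructure`); with `e, c` as the last two basis vectors (`stub_basisWithTwo`, `stub_linearTransport`)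
`g₁(w ‖ a ‖ b) = E(w) ⊕ a·D(w) ⊕ b·(a ⊕ Q(w))`; the level-5 parity on the heavy hyperplane is quadratic
(`stub_levelOnHyperplane`) with `< 128` zeros by the cost identity `Σ (W − 32 S)² = 2²¹(1 − Φ)`, hence none; peeling
(`stub_tenPeel`) makes the slices `G[·,b₀]` bent and `G[·,¬b₀]` type O, and the 8-bit endgame (`stub_eightBitEndgame` with
`stub_typeE8`) caps `Φ` at `7/8`.  All eight stubs were landed by worker waves 2–3; axioms are the standard three.
Sources: Ax (1964) / McEliece (1972); O. S. Rothaus, JCTA 20 (1976); X.-D. Hou, Discrete Math. 189 (1998); C. Carlet,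
*Boolean Functions for Cryptography and Coding Theory*, CUP 2021; S. Aaronson, A. Ambainis, SIAM J. Comput. 47 (2018).
-/

set_option linter.dupNamespace false -- D-0017: single-problem summit ⇒ `QuantumAdvantage.QuantumAdvantage` by design

noncomputable section

namespace Summit.QuantumAdvantage.QuantumAdvantage.Theorems.CubicForrelation.NearExactIsExact

open Finset
open scoped Matrix
open Literature.Computability.QuantumComplexity
open Literature.Computability.QuantumComplexity.BuzetChailloux (bxor zeroVec signOf_sq)
open Literature.Computability.QuantumComplexity.DerivativeWalsh (W sum_W_sq)
open Summit.QuantumAdvantage.QuantumAdvantage.Theorems.ExactPairsMaioranaMcFarland.Negative (ind ind_apply ind_injective)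
open Summit.QuantumAdvantage.QuantumAdvantage.Theorems.CubicForrelation.ExactPairsMaioranaMcFarland (dnf_twist_eq_chi)
open Summit.QuantumAdvantage.QuantumAdvantage.Theorems.SignedExactCubicForrelationNotPrBPP (eq_of_signOf_eq)

/-! ### The balanced split is empty: the derivative of `g` along its split covector is unbalanced -/

/-- **The balanced split is empty (n = 10, θ = 7/8): the derivative of `g` along its split covector is UNBALANCED.**
For cubic `f, g : 𝔽₂¹⁰ → 𝔽₂` with `Φ(f,g) > 7/8`, if `W_g = 16u` and the parity of `u` is the affine character
`(−1)^{b₀}(−1)^{c·x}`, non-constant, then `Σ_y (−1)^{g(y) ⊕ g(y ⊕ c)} ≠ 0`.  Proof (the 10-step plan of the lead's notes):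
a balanced `δ = D_c g` has a complementing structure `e` (`stub_quadBalancedStructure`); a basis with `e, c` last
(`stub_basisWithTwo`) transported by `stub_linearTransport` gives the normal form `g₁(w ‖ a ‖ b) = E w ⊕ aD w ⊕ b(a ⊕ Q w)`;
on the heavy hyperplane the level-5 parity is quadratic (`stub_levelOnHyperplane`) and the cost identity
`Σ (W − 32 S)² = 2²¹(1 − Φ)` leaves `< 128` even values, hence none (Reed–Muller); peeling (`stub_tenPeel`) then makes the
slices `G[·,b₀]` bent (Parseval) and `G[·,¬b₀]` type O, and the 8-bit endgame (`stub_eightBitEndgame` with `stub_typeE8`: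
type-O capacity `7/8`, `d(RM(4,8)) = 16`, Hou at `n = 8`, type E of quadratic perturbations of cubic bent functions)
contradicts `Φ > 7/8`. [this line: lead c6, waves 2–3] -/
theorem ten_splitDerivative_unbalanced :
    ∀ (f g : (Fin (4 + 4 + 1 + 1) → Bool) → Bool), IsDegLeFun 3 f → IsDegLeFun 3 g → 7 / 8 < forrelation f g →
      ∀ (u : (Fin (4 + 4 + 1 + 1) → Bool) → ℤ) (c : Fin (4 + 4 + 1 + 1) → Bool) (b₀ : Bool),
        (∀ x, W (fun y => signOf (g y)) x = (2 : ℝ) ^ 4 * (u x : ℝ)) →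
        (∀ x, signOf (decide (Odd (u x))) = signOf b₀ * twist c x) →
        (∃ x, Odd (u x)) → (∃ x, ¬ Odd (u x)) → ∑ y, signOf (g y ^^ g (bxor y c)) ≠ 0 := by
  intro f g hf hg hΦ u c b₀ hu hc hodd heven hbal
  -- Step 1: the derivative `δ = D_c g` is a balanced quadratic, hence has a complementing structure `e`.
  have hδdeg : IsDegLeFun 2 (fun y => g y ^^ g (bxor y c)) := stub_derivDegree _ 2 g c hg
  obtain ⟨e, he0, he⟩ := stub_quadBalancedStructure _ _ hδdeg hbal
  have hδc : ∀ y, (g (bxor y c) ^^ g (bxor (bxor y c) c)) = (g y ^^ g (bxor y c)) := fun y => by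
    rw [show bxor (bxor y c) c = y from funext fun i => by
      show ((y i ^^ c i) ^^ c i) = y i
      cases y i <;> cases c i <;> rfl, Bool.xor_comm]
  -- Step 2: `e ≠ c` and `c ≠ 0`.
  have hec : e ≠ c := by
    rintro rfl
    have h1 := he zeroVec
    rw [BuzetChailloux.zeroVec_bxor] at h1
    have h2 := hδc zeroVec
    rw [BuzetChailloux.zeroVec_bxor] at h2
    rw [h2] at h1
    revert h1
    cases (g zeroVec ^^ g e) <;> decide
  have hc0 : c ≠ zeroVec := by
    rintro rfl
    obtain ⟨x₁, hx₁⟩ := hodd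
    obtain ⟨x₂, hx₂⟩ := heven
    have htw : ∀ x : Fin (4 + 4 + 1 + 1) → Bool, twist (zeroVec : Fin (4 + 4 + 1 + 1) → Bool) x = 1 := fun x => by
      unfold twist; exact Finset.prod_eq_one fun i _ => by simp [BuzetChailloux.zeroVec]
    have e1 := eq_of_signOf_eq ((hc x₁).trans (by rw [htw, mul_one]))
    have e2 := eq_of_signOf_eq ((hc x₂).trans (by rw [htw, mul_one]))
    rw [decide_eq_true hx₁] at e1; rw [decide_eq_false hx₂] at e2
    exact Bool.false_ne_true (e2.trans e1.symm)
  -- Step 3: an invertible matrix `N` with columns `e, c` in the last two positions.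
  have hie : ind e ≠ 0 := fun h => he0 (ind_injective (h.trans tb_ind_zeroVec.symm))
  have hic : ind c ≠ 0 := fun h => hc0 (ind_injective (h.trans tb_ind_zeroVec.symm))
  have hiec : ind e ≠ ind c := fun h => hec (ind_injective h)
  obtain ⟨N, N', hN'N, hNe, hNc⟩ := stub_basisWithTwo 8 (ind e) (ind c) hie hic hiec
  -- Step 4: transport `f₁ = f ∘ N'ᵀ`, `g₁ = g ∘ N` (same forrelation, cubic, `W_{g₁}(x) = W_g(N'ᵀ x)`).
  have hMM : Nᵀ * N'ᵀ = 1 := by rw [← Matrix.transpose_mul, hN'N, Matrix.transpose_one]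
  obtain ⟨hΦeq, hWeq⟩ := stub_linearTransport _ N'ᵀ Nᵀ hMM f g
  simp only [Matrix.transpose_transpose] at hΦeq hWeq
  set g₁ : (Fin (4 + 4 + 1 + 1) → Bool) → Bool := fun y => g (fun i => decide ((N *ᵥ ind y) i = 1)) with hg₁def
  set f₁ : (Fin (4 + 4 + 1 + 1) → Bool) → Bool := fun x => f (fun i => decide ((N'ᵀ *ᵥ ind x) i = 1))
    with hf₁def
  have hrd : ∀ v : Fin (4 + 4 + 1 + 1) → ZMod 2, ind (fun i => decide (v i = 1)) = v := fun v => by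
    funext i
    exact (by decide : ∀ a : ZMod 2, (if decide (a = 1) = true then (1 : ZMod 2) else 0) = a) (v i)
  have hg₁ : IsDegLeFun 3 g₁ := nf_isDegLeFun_mulVec N (fun v i => decide (v i = 1)) hrd hg
  have hf₁ : IsDegLeFun 3 f₁ := nf_isDegLeFun_mulVec N'ᵀ (fun v i => decide (v i = 1)) hrd hf
  -- unit vectors `e₈, e₉` and their images under `N`
  set e₈ : Fin (4 + 4 + 1 + 1) → Bool := fun j => decide (j = (⟨8, by norm_num⟩ : Fin (4 + 4 + 1 + 1))) with he₈
  set e₉ : Fin (4 + 4 + 1 + 1) → Bool := fun j => decide (j = (⟨9, by norm_num⟩ : Fin (4 + 4 + 1 + 1))) with he₉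
  have hT8 : ∀ y : Fin (4 + 4 + 1 + 1) → Bool,
      (fun i => decide ((N *ᵥ ind (bxor y e₈)) i = 1)) = bxor (fun i => decide ((N *ᵥ ind y) i = 1)) e := by
    intro y
    rw [tb_ind_bxor, Matrix.mulVec_add, he₈, tb_ind_single, hNe, tb_rd_add_ind]
  have hT9 : ∀ y : Fin (4 + 4 + 1 + 1) → Bool,
      (fun i => decide ((N *ᵥ ind (bxor y e₉)) i = 1)) = bxor (fun i => decide ((N *ᵥ ind y) i = 1)) c := by
    intro y
    rw [tb_ind_bxor, Matrix.mulVec_add, he₉, tb_ind_single, hNc, tb_rd_add_ind]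
  have hg₁8 : ∀ y, g₁ (bxor y e₈) = g (bxor (fun i => decide ((N *ᵥ ind y) i = 1)) e) := fun y => by
    simp only [hg₁def]; rw [hT8]
  have hg₁9 : ∀ y, g₁ (bxor y e₉) = g (bxor (fun i => decide ((N *ᵥ ind y) i = 1)) c) := fun y => by
    simp only [hg₁def]; rw [hT9]
  -- the transported derivative `δ₁ = D_{e₉} g₁ = δ ∘ N`: complementing structure `e₈`, period `e₉`
  have hP1 : ∀ y, (g₁ (bxor y e₈) ^^ g₁ (bxor (bxor y e₈) e₉)) = !(g₁ y ^^ g₁ (bxor y e₉)) := by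
    intro y; rw [hg₁9, hT8, hg₁8, hg₁9]; exact he _
  have hP2 : ∀ y, (g₁ (bxor y e₉) ^^ g₁ (bxor (bxor y e₉) e₉)) = (g₁ y ^^ g₁ (bxor y e₉)) := by
    intro y; rw [hg₁9 (bxor y e₉), hT9 y, hg₁9 y]; exact hδc _
  -- Step 5: the normal form `g₁(w ‖ a ‖ b) = E w ⊕ (a ∧ D w) ⊕ (b ∧ (a ⊕ Q w))`.
  have h9 : ∀ v : Fin (4 + 4 + 1) → Bool,
      (Fin.snoc v true : Fin (4 + 4 + 1 + 1) → Bool) = bxor (Fin.snoc v false) e₉ := fun v => by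
    rw [tb_snoc_true]; rfl
  have h8 : ∀ (w : Fin (4 + 4) → Bool) (b : Bool),
      (Fin.snoc (Fin.snoc w true : Fin (4 + 4 + 1) → Bool) b : Fin (4 + 4 + 1 + 1) → Bool) =
        bxor (Fin.snoc (Fin.snoc w false : Fin (4 + 4 + 1) → Bool) b) e₈ := fun w b => by
    rw [tb_snoc_snoc_true]; rfl
  obtain ⟨E, hE⟩ : ∃ E : (Fin (4 + 4) → Bool) → Bool,
      ∀ w, E w = g₁ (Fin.snoc (Fin.snoc w false) false) := ⟨_, fun _ => rfl⟩
  obtain ⟨D, hD⟩ : ∃ D : (Fin (4 + 4) → Bool) → Bool,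
      ∀ w, D w = (g₁ (Fin.snoc (Fin.snoc w false) false) ^^ g₁ (Fin.snoc (Fin.snoc w true) false)) :=
    ⟨_, fun _ => rfl⟩
  obtain ⟨Q, hQ⟩ : ∃ Q : (Fin (4 + 4) → Bool) → Bool,
      ∀ w, Q w = (g₁ (Fin.snoc (Fin.snoc w false) false) ^^
        g₁ (bxor (Fin.snoc (Fin.snoc w false) false) e₉)) := ⟨_, fun _ => rfl⟩
  -- `δ₁(w ‖ a ‖ false) = Q w ⊕ a`
  have hQa : ∀ (w : Fin (4 + 4) → Bool) (a : Bool),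
      (g₁ (Fin.snoc (Fin.snoc w a) false) ^^ g₁ (bxor (Fin.snoc (Fin.snoc w a) false) e₉)) = (Q w ^^ a) := by
    intro w a
    cases a
    · rw [hQ, Bool.xor_false]
    · rw [h8 w false, hP1, ← hQ w, Bool.xor_true]
  have hshape : ∀ (w : Fin (4 + 4) → Bool) (a b : Bool),
      g₁ (Fin.snoc (Fin.snoc w a) b) = (E w ^^ (a && D w) ^^ (b && (a ^^ Q w))) := by
    intro w a b
    have hb1 : g₁ (Fin.snoc (Fin.snoc w a) true) = (g₁ (Fin.snoc (Fin.snoc w a) false) ^^ (Q w ^^ a)) := by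
      rw [← hQa w a, h9, ← Bool.xor_assoc, Bool.xor_self, Bool.false_xor]
    have ha1 : g₁ (Fin.snoc (Fin.snoc w true) false) = (E w ^^ D w) := by
      rw [hD, hE, ← Bool.xor_assoc, Bool.xor_self, Bool.false_xor]
    cases b
    · cases a
      · rw [hE]; simp
      · rw [ha1]; simp
    · rw [hb1]
      cases a
      · rw [← hE w]; simp
      · rw [ha1]; cases E w <;> cases D w <;> cases Q w <;> decide
  -- degrees of `E, D, Q`
  have hEdeg : IsDegLeFun 3 E := by
    rw [show E = fun w => g₁ (Fin.snoc (Fin.snoc w false) false) from funext hE]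
    exact tb_isDegLeFun_snoc (tb_isDegLeFun_snoc (F := g₁) hg₁ false) false
  have hQdeg : IsDegLeFun 2 Q := by
    rw [show Q = fun w => (fun y => g₁ y ^^ g₁ (bxor y e₉)) (Fin.snoc (Fin.snoc w false) false) from funext hQ]
    exact tb_isDegLeFun_snoc (tb_isDegLeFun_snoc (F := fun y => g₁ y ^^ g₁ (bxor y e₉))
      (stub_derivDegree _ 2 g₁ e₉ hg₁) false) false
  have hDdeg : IsDegLeFun 2 D := by
    have hg₁' : IsDegLeFun 3 (fun v : Fin (4 + 4 + 1) → Bool => g₁ (Fin.snoc v false)) :=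
      tb_isDegLeFun_snoc (F := g₁) hg₁ false
    have hder := stub_derivDegree _ 2 (fun v : Fin (4 + 4 + 1) → Bool => g₁ (Fin.snoc v false))
      (fun j => decide (j = Fin.last (4 + 4))) hg₁'
    rw [show D = fun w => (fun v : Fin (4 + 4 + 1) → Bool => g₁ (Fin.snoc v false) ^^
        g₁ (Fin.snoc (bxor v fun j => decide (j = Fin.last (4 + 4))) false)) (Fin.snoc w false) from
      funext fun w => by rw [hD, tb_snoc_true w]]
    exact tb_isDegLeFun_snoc hder false
  -- Step 6: the Walsh side: `W_{g₁} = 16 u₁` with `u₁` odd exactly on the hyperplane `x₉ = ¬b₀`.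
  have hW₁ : ∀ x, W (fun y => signOf (g₁ y)) x = (2 : ℝ) ^ 4 * (u (fun i => decide ((N'ᵀ *ᵥ ind x) i = 1)) : ℝ) :=
    fun x => by simp only [hg₁def]; rw [hWeq x, hu]
  have h9vec : (fun i => decide ((N' *ᵥ ind c) i = 1)) = e₉ := by
    rw [← hNc, Matrix.mulVec_mulVec, hN'N, Matrix.one_mulVec]
    funext i
    rw [he₉, Pi.single_apply]
    by_cases h : i = ⟨9, by norm_num⟩ <;> simp [h]
  have hpar : ∀ x : Fin (4 + 4 + 1 + 1) → Bool,
      decide (Odd (u (fun i => decide ((N'ᵀ *ᵥ ind x) i = 1)))) = (b₀ ^^ x ⟨9, by norm_num⟩) := by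
    intro x
    have h1 := hc (fun i => decide ((N'ᵀ *ᵥ ind x) i = 1))
    have htw : twist c (fun i => decide ((N'ᵀ *ᵥ ind x) i = 1)) = twist (fun i => decide ((N' *ᵥ ind c) i = 1)) x := by
      rw [dnf_twist_eq_chi, dnf_twist_eq_chi, hrd, hrd, Matrix.dotProduct_mulVec, ← Matrix.mulVec_transpose,
        Matrix.transpose_transpose]
    rw [htw, h9vec, he₉, tb_twist_single, ← signOf_xor] at h1
    exact eq_of_signOf_eq h1
  -- Step 7: on the hyperplane `x₉ = b₀` the level-5 parity `u₅ = u₁/2` is quadratic (relative tower).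
  have hlast : ∀ (v : Fin (4 + 4 + 1) → Bool) (t : Bool),
      (Fin.snoc v t : Fin (4 + 4 + 1 + 1) → Bool) ⟨9, by norm_num⟩ = t := fun v t => by
    show (Fin.snoc v t : Fin (4 + 4 + 1 + 1) → Bool) (Fin.last (4 + 4 + 1)) = t
    exact Fin.snoc_last (α := fun _ => Bool) t v
  have heven5 : ∀ v : Fin (4 + 4 + 1) → Bool,
      Even (u (fun i => decide ((N'ᵀ *ᵥ ind (Fin.snoc v b₀ : Fin (4 + 4 + 1 + 1) → Bool)) i = 1))) := by
    intro v
    have h := hpar (Fin.snoc v b₀)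
    rw [hlast, Bool.xor_self, decide_eq_false_iff_not] at h
    exact Int.not_odd_iff_even.1 h
  obtain ⟨u₅, hu₅⟩ : ∃ u₅ : (Fin (4 + 4 + 1) → Bool) → ℤ, ∀ v,
      u (fun i => decide ((N'ᵀ *ᵥ ind (Fin.snoc v b₀ : Fin (4 + 4 + 1 + 1) → Bool)) i = 1)) = 2 * u₅ v := by
    refine ⟨fun v => u (fun i => decide ((N'ᵀ *ᵥ ind (Fin.snoc v b₀ : Fin (4 + 4 + 1 + 1) → Bool)) i = 1)) / 2,
      fun v => ?_⟩
    show _ = 2 * (u _ / 2)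
    obtain ⟨k, hk⟩ := heven5 v
    omega
  have hW5 : ∀ v : Fin (4 + 4 + 1) → Bool,
      W (fun y => signOf (g₁ y)) (Fin.snoc v b₀) = (2 : ℝ) ^ 5 * (u₅ v : ℝ) := fun v => by
    rw [hW₁, hu₅]; push_cast; ring
  have hdeg5 : IsDegLeFun 2 (fun v => decide (Odd (u₅ v))) :=
    stub_levelOnHyperplane stub_axParity 9 5 2 g₁ b₀ u₅ hg₁ hW5 (by intro k hk hk9; omega)
  -- Step 8: the cost identity forces `u₅` odd everywhere.
  have hcost : ∑ x, (W (fun y => signOf (g₁ y)) x - 32 * signOf (f₁ x)) ^ 2 =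
      (2 : ℝ) ^ 21 * (1 - forrelation f₁ g₁) := by
    have hP : ∑ x, W (fun y => signOf (g₁ y)) x ^ 2 = (2 : ℝ) ^ 20 := by
      rw [sum_W_sq]
      simp only [signOf_sq, Finset.sum_const, Finset.card_univ, Fintype.card_fun, Fintype.card_bool,
        Fintype.card_fin, nsmul_eq_mul, mul_one]
      norm_num
    have hF : ∑ x, signOf (f₁ x) * W (fun y => signOf (g₁ y)) x = (2 : ℝ) ^ 15 * forrelation f₁ g₁ := by
      have h := vg_two_pow_mul_forrelation (m := 5) f₁ g₁
      norm_num at h ⊢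
      exact h.symm
    have hS : ∑ x : Fin (4 + 4 + 1 + 1) → Bool, signOf (f₁ x) ^ 2 = (2 : ℝ) ^ 10 := by
      simp only [signOf_sq, Finset.sum_const, Finset.card_univ, Fintype.card_fun, Fintype.card_bool,
        Fintype.card_fin, nsmul_eq_mul, mul_one]
      norm_num
    have hexp : ∀ x, (W (fun y => signOf (g₁ y)) x - 32 * signOf (f₁ x)) ^ 2 =
        W (fun y => signOf (g₁ y)) x ^ 2 - 64 * (signOf (f₁ x) * W (fun y => signOf (g₁ y)) x) +
          1024 * signOf (f₁ x) ^ 2 := fun x => by ring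
    simp only [hexp, Finset.sum_add_distrib, Finset.sum_sub_distrib, ← Finset.mul_sum, hP, hF, hS]
    ring
  have hodd5 : ∀ v, Odd (u₅ v) := by
    -- split the cost sum along the last coordinate
    have hsplit := tb_sum_snoc (fun x => (W (fun y => signOf (g₁ y)) x - 32 * signOf (f₁ x)) ^ 2)
    rw [hcost] at hsplit
    -- the `x₉ = ¬b₀` terms are each `≥ 256`, the `x₉ = b₀` terms are `1024 (u₅ − S)²`
    have hH : ∀ v : Fin (4 + 4 + 1) → Bool,
        (256 : ℝ) ≤ (W (fun y => signOf (g₁ y)) (Fin.snoc v (!b₀)) - 32 * signOf (f₁ (Fin.snoc v (!b₀)))) ^ 2 := by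
      intro v
      have hox : Odd (u (fun i => decide ((N'ᵀ *ᵥ ind (Fin.snoc v (!b₀) : Fin (4 + 4 + 1 + 1) → Bool)) i = 1))) := by
        have h := hpar (Fin.snoc v (!b₀))
        rw [hlast, Bool.xor_not_self, decide_eq_true_iff] at h
        exact h
      rw [hW₁]
      have h1 := tb_one_le_sq_odd_sub _ hox (f₁ (Fin.snoc v (!b₀)))
      nlinarith [h1]
    have hH' : ∀ v : Fin (4 + 4 + 1) → Bool,
        (W (fun y => signOf (g₁ y)) (Fin.snoc v b₀) - 32 * signOf (f₁ (Fin.snoc v b₀))) ^ 2 =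
          1024 * ((u₅ v : ℝ) - signOf (f₁ (Fin.snoc v b₀))) ^ 2 := fun v => by
      rw [hW5]; ring
    have hbool : ∀ v : Fin (4 + 4 + 1) → Bool,
        ∑ t : Bool, (W (fun y => signOf (g₁ y)) (Fin.snoc v t) - 32 * signOf (f₁ (Fin.snoc v t))) ^ 2 =
          1024 * ((u₅ v : ℝ) - signOf (f₁ (Fin.snoc v b₀))) ^ 2 +
            (W (fun y => signOf (g₁ y)) (Fin.snoc v (!b₀)) - 32 * signOf (f₁ (Fin.snoc v (!b₀)))) ^ 2 := by
      intro v
      rw [Fintype.sum_bool]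
      cases b₀
      · rw [← hH']; simp only [Bool.not_false]; ring
      · rw [← hH']; simp only [Bool.not_true]
    simp only [hbool, Finset.sum_add_distrib] at hsplit
    have hHsum : (2 : ℝ) ^ 17 ≤ ∑ v : Fin (4 + 4 + 1) → Bool,
        (W (fun y => signOf (g₁ y)) (Fin.snoc v (!b₀)) - 32 * signOf (f₁ (Fin.snoc v (!b₀)))) ^ 2 := by
      calc (2 : ℝ) ^ 17 = ∑ _v : Fin (4 + 4 + 1) → Bool, (256 : ℝ) := by
            simp only [Finset.sum_const, Finset.card_univ, Fintype.card_fun, Fintype.card_bool, Fintype.card_fin,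
              nsmul_eq_mul]; norm_num
        _ ≤ _ := Finset.sum_le_sum fun v _ => hH v
    have hΦ₁ : 7 / 8 < forrelation f₁ g₁ := by rw [hΦeq]; exact hΦ
    have hsmall : ∑ v : Fin (4 + 4 + 1) → Bool, ((u₅ v : ℝ) - signOf (f₁ (Fin.snoc v b₀))) ^ 2 < 128 := by
      rw [← Finset.mul_sum] at hsplit
      nlinarith [hsplit, hHsum, hΦ₁]
    -- fewer than 128 even values, so none (RM weight of the quadratic parity)
    by_contra hno
    push Not at hno
    obtain ⟨v₀, hv₀⟩ := hno
    have hdegE : IsDegLeFun 2 (fun v => !decide (Odd (u₅ v))) := by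
      simpa only [Bool.xor_true] using tb_isDegLeFun_xor_const hdeg5 true
    have hR := bb_rmWeight_holds (4 + 4 + 1) 2 (fun v => !decide (Odd (u₅ v))) hdegE
      ⟨v₀, by simpa using hv₀⟩
    have hcard : ((univ.filter fun v : Fin (4 + 4 + 1) → Bool => (!decide (Odd (u₅ v))) = true).card : ℝ) ≤
        ∑ v : Fin (4 + 4 + 1) → Bool, ((u₅ v : ℝ) - signOf (f₁ (Fin.snoc v b₀))) ^ 2 := by
      calc ((univ.filter fun v : Fin (4 + 4 + 1) → Bool => (!decide (Odd (u₅ v))) = true).card : ℝ)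
          = ∑ v ∈ univ.filter (fun v : Fin (4 + 4 + 1) → Bool => (!decide (Odd (u₅ v))) = true), (1 : ℝ) := by simp
        _ ≤ ∑ v ∈ univ.filter (fun v : Fin (4 + 4 + 1) → Bool => (!decide (Odd (u₅ v))) = true),
              ((u₅ v : ℝ) - signOf (f₁ (Fin.snoc v b₀))) ^ 2 := by
            refine Finset.sum_le_sum fun v hv => ?_
            rw [Finset.mem_filter] at hv
            have hev : Even (u₅ v) := by
              have := hv.2; simp only [Bool.not_eq_true', decide_eq_false_iff_not] at this
              exact Int.not_odd_iff_even.1 this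
            exact tb_one_le_sq_even_sub _ hev _
        _ ≤ _ := Finset.sum_le_sum_of_subset_of_nonneg (Finset.filter_subset _ _) fun v _ _ => sq_nonneg _
    have h128 : (128 : ℝ) ≤ ((univ.filter fun v : Fin (4 + 4 + 1) → Bool => (!decide (Odd (u₅ v))) = true).card : ℝ) := by
      have : 2 ^ (4 + 4 + 1) ≤ 2 ^ 2 * (univ.filter fun v : Fin (4 + 4 + 1) → Bool => (!decide (Odd (u₅ v))) = true).card := hR
      have : 128 ≤ (univ.filter fun v : Fin (4 + 4 + 1) → Bool => (!decide (Odd (u₅ v))) = true).card := by omega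
      exact_mod_cast this
    linarith
  -- Step 9: peel; the `x₉ = b₀` slices are BENT, the `x₉ = ¬b₀` slices are TYPE O.
  obtain ⟨hWp, hΦp⟩ := stub_tenPeel E D Q f₁ g₁ hshape
  have hbent : ∀ (a : Bool) (x : Fin (4 + 4) → Bool),
      W (fun w => signOf (E w ^^ (Q w && D w) ^^ (a && Q w) ^^ (b₀ && D w))) x ^ 2 = (2 : ℝ) ^ (4 + 4) := by
    intro a
    -- `W_G = ± 16 u₅(· ‖ a)`
    have hWG : ∀ x : Fin (4 + 4) → Bool,
        W (fun w => signOf (E w ^^ (Q w && D w) ^^ (a && Q w) ^^ (b₀ && D w))) x =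
          16 * signOf (a && b₀) * (u₅ (Fin.snoc x a) : ℝ) := by
      intro x
      have h1 := hWp x a b₀
      rw [hW5] at h1
      have hs : signOf (a && b₀) * signOf (a && b₀) = 1 := by rw [← sq, signOf_sq]
      have h2 : W (fun w => signOf (E w ^^ (Q w && D w) ^^ (a && Q w) ^^ (b₀ && D w))) x =
          signOf (a && b₀) * (signOf (a && b₀) *
            W (fun w => signOf (E w ^^ (Q w && D w) ^^ (a && Q w) ^^ (b₀ && D w))) x) := by
        rw [← mul_assoc, hs, one_mul]
      rw [h2]
      have h3 : signOf (a && b₀) * W (fun w => signOf (E w ^^ (Q w && D w) ^^ (a && Q w) ^^ (b₀ && D w))) x =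
          (2 : ℝ) ^ 4 * (u₅ (Fin.snoc x a) : ℝ) := by linarith
      rw [h3]; ring
    -- Parseval on 8 bits: `Σ_x u₅(x ‖ a)² = 256`, all terms odd squares `≥ 1`, hence all `= 1`
    have hPars : ∑ x : Fin (4 + 4) → Bool, (u₅ (Fin.snoc x a) : ℝ) ^ 2 = 256 := by
      have hP := sum_W_sq (fun w => signOf (E w ^^ (Q w && D w) ^^ (a && Q w) ^^ (b₀ && D w)))
      simp only [signOf_sq, Finset.sum_const, Finset.card_univ, Fintype.card_fun, Fintype.card_bool,
        Fintype.card_fin, nsmul_eq_mul, mul_one] at hP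
      simp only [hWG, mul_pow, signOf_sq, mul_one, ← Finset.mul_sum] at hP
      norm_num at hP
      linarith
    have hone : ∀ x : Fin (4 + 4) → Bool, u₅ (Fin.snoc x a) ^ 2 = 1 := by
      have hZ : ∑ x : Fin (4 + 4) → Bool, u₅ (Fin.snoc x a) ^ 2 = 256 := by exact_mod_cast hPars
      have hall := tb_all_one_of_sum_le (univ : Finset (Fin (4 + 4) → Bool)) (fun x => u₅ (Fin.snoc x a) ^ 2)
        (fun x _ => by
          obtain ⟨m, hm⟩ := hodd5 (Fin.snoc x a)
          rw [hm]
          rcases le_or_gt 0 m with h0 | h0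
          · nlinarith
          · have : 2 * m + 1 ≤ -1 := by omega
            nlinarith)
        (by
          rw [hZ]
          simp only [Finset.card_univ, Fintype.card_fun, Fintype.card_bool, Fintype.card_fin]
          norm_num)
      exact fun x => hall x (Finset.mem_univ x)
    intro x
    rw [hWG, mul_pow, mul_pow, signOf_sq]
    have h1 : ((u₅ (Fin.snoc x a) : ℝ)) ^ 2 = 1 := by exact_mod_cast hone x
    rw [h1]; norm_num
  have htypeO : ∀ (a : Bool) (x : Fin (4 + 4) → Bool), ∃ k : ℤ,
      W (fun w => signOf (E w ^^ (Q w && D w) ^^ (a && Q w) ^^ (!b₀ && D w))) x = 8 * (2 * k + 1) := by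
    intro a x
    have h1 := hWp x a (!b₀)
    rw [hW₁] at h1
    have hox : Odd (u (fun i => decide ((N'ᵀ *ᵥ ind
        (Fin.snoc (Fin.snoc x a : Fin (4 + 4 + 1) → Bool) (!b₀) : Fin (4 + 4 + 1 + 1) → Bool)) i = 1))) := by
      have h := hpar (Fin.snoc (Fin.snoc x a) (!b₀))
      rw [hlast, Bool.xor_not_self, decide_eq_true_iff] at h
      exact h
    obtain ⟨m, hm⟩ := hox
    have hsdich : signOf (a && !b₀) = 1 ∨ signOf (a && !b₀) = -1 := by
      cases (a && !b₀) <;> simp [signOf]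
    rcases hsdich with hsg | hsg
    · refine ⟨m, ?_⟩
      rw [hsg] at h1
      have : W (fun w => signOf (E w ^^ (Q w && D w) ^^ (a && Q w) ^^ (!b₀ && D w))) x =
          8 * (u (fun i => decide ((N'ᵀ *ᵥ ind
            (Fin.snoc (Fin.snoc x a : Fin (4 + 4 + 1) → Bool) (!b₀) : Fin (4 + 4 + 1 + 1) → Bool)) i = 1)) : ℝ) := by
        linarith
      rw [this, hm]; push_cast; ring
    · refine ⟨-m - 1, ?_⟩
      rw [hsg] at h1
      have : W (fun w => signOf (E w ^^ (Q w && D w) ^^ (a && Q w) ^^ (!b₀ && D w))) x =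
          -8 * (u (fun i => decide ((N'ᵀ *ᵥ ind
            (Fin.snoc (Fin.snoc x a : Fin (4 + 4 + 1) → Bool) (!b₀) : Fin (4 + 4 + 1 + 1) → Bool)) i = 1)) : ℝ) := by
        linarith
      rw [this, hm]; push_cast; ring
  -- Step 10: the 8-bit endgame.
  have hF : ∀ a b' : Bool, IsDegLeFun 3 (fun x : Fin (4 + 4) → Bool => f₁ (Fin.snoc (Fin.snoc x a) b') ^^ (a && b')) :=
    fun a b' => tb_isDegLeFun_xor_const (tb_isDegLeFun_snoc (tb_isDegLeFun_snoc (F := f₁) hf₁ b') a) (a && b')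
  have hend := stub_eightBitEndgame stub_typeE8 E D Q (fun a b' x => f₁ (Fin.snoc (Fin.snoc x a) b') ^^ (a && b')) (!b₀)
    hEdeg hDdeg hQdeg hF (fun a x => by rw [Bool.not_not]; exact hbent a x) htypeO
  apply hend
  rw [← hΦp, hΦeq]
  exact hΦ

end Summit.QuantumAdvantage.QuantumAdvantage.Theorems.CubicForrelation.NearExactIsExact
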